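import Summits.Ventures.HSemireg.Pad4TowerSeedB1OddFloor

/-!
# Venture HSemireg — PAD-4 on 𝔅(μ₄): the LEVEL-TRANSFER form of the A2I⁻ swap kill under `S₄`-closure (gs-eng-2 g53)

HONEST FRAMING. Lean index of the computation cell `pub-hsemireg` (S4-PUSH, H2 door PAD-4, line stmt-HodgeConjecture-18881), written by the
cell's second-code engine `gs-eng-2` (g53); sequel of `Pad4TowerSeedB1OddFloor` (1002: LEMMA A′ `a2i_swap_kill`). Census-neutral: a lemma
ABOUT THE TYPED STATIC PREDICATE `A2IMinusClosed` and the closure predicate `PermClosed`; nothing here is an object, a σ, a seed or a census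
row; NOTHING HERE SAYS THAT HC ∕ HC_CM ∕ HC_AV ∕ H2 HOLDS OR FAILS. No `sorry`, no `axiom`, no `instance`, no notation, no Literature fact.

WHAT. Motif (M1) of the ◇₈ peel (all 7 547 two-literal A2I⁻ conflicts; memo `PENCIL-B1ODD-gs2g53.md` §5e) in the form that USES THE SYMMETRY
HYPOTHESIS OF THE SEED: on a support whose two levels are `S₄`-closed (`PermClosed`, half of `G1Closed`), an `N`-cell `Z` with the apex `O` on
a factor `f′` and a floor unit letter `ℓ_u` on a factor `σ ≠ f′`, whose cancellation `Z(σ ↦ O)` is a `P`-cell, IS ITSELF A `P`-CELL — uniformly in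
the height `h`. Proof: the transposition `(σ f′)` of `S₄` carries `Z` to the swapped cell `Z(σ ↦ O, f′ ↦ ℓ_u)` (`perm_swap_eq_update`), which is
therefore an `N`-cell; LEMMA A′ makes it a `P`-cell; the same transposition carries it back to `Z` inside `C.upper`. This is the one place
where the `S₄` half of `G₁` enters the A2I⁻ side of the static game (LEMMA T: the statics themselves are torus- and hence phase-blind).
**`level_transfer_of_cancellation`**; auxiliary `perm_swap_eq_update`, `perm_swap_swap`.

SOURCES: `Pad4TowerSeedB1OddFloor.lean` (1002, `a2i_swap_kill`), `Pad4TowerPermWindow.lean` (`MCell.perm`, `PermClosed`),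
`Pad4TowerSeedB1OddLemmas.lean` (`fu`); `gs2∕g53∕j309861∕G1DECODE-peel-d8.txt` (g = the transposition in every decoded (M1) row). -/

namespace Summit.Ventures.HSemireg.Pad4Tower

open Finset

/-- permuting the factors of `Z` by the transposition `(σ f′)` is the double update that swaps the two letters. -/
theorem perm_swap_eq_update (Z : MCell) {σ f' : Fin 4} (hf : f' ≠ σ) :
    Z.perm (Equiv.swap σ f') = Function.update (Function.update Z σ (Z f')) f' (Z σ) := by
  funext g
  simp only [MCell.perm]
  by_cases hg : g = f'
  · subst hg; simp [Equiv.swap_apply_right]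
  · rw [Function.update_of_ne hg]
    by_cases hg' : g = σ
    · subst hg'; simp [Equiv.swap_apply_left]
    · rw [Function.update_of_ne hg', Equiv.swap_apply_of_ne_of_ne hg' hg]

/-- the transposition is an involution on cells. -/
theorem perm_swap_swap (Z : MCell) (σ f' : Fin 4) : (Z.perm (Equiv.swap σ f')).perm (Equiv.swap σ f') = Z := by
  funext g; simp [MCell.perm, Equiv.swap_apply_self]

/-- **LEVEL TRANSFER (motif (M1) under `S₄`-closure, uniform in h).** In an `A2I⁻`-closed configuration inside ◇_h whose two levels are
closed under the factor permutations, an `N`-cell `Z` with `Z f′ = O` and `Z σ = ℓ_u` (`σ ≠ f′`) whose cancellation `Z(σ ↦ O)` is a `P`-cell is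
itself a `P`-cell. [`PermClosed C.lower` ⇒ the swapped cell is an `N`-cell; `a2i_swap_kill` ⇒ it is a `P`-cell; `PermClosed C.upper` ⇒ so is `Z`] -/
theorem level_transfer_of_cancellation {C : MConfig} {h : ℤ} (hU : C.InDiamond h) (hA : A2IMinusClosed C)
    (hPl : PermClosed C.lower) (hPu : PermClosed C.upper) {Z : MCell} (hZ : Z ∈ C.lower)
    {σ f' : Fin 4} (hf : f' ≠ σ) {u : Fin 4} (hZσ : Z σ = fu u) (hZf : Z f' = (0, 0, 0))
    (hq : Function.update Z σ (0, 0, 0) ∈ C.upper) : Z ∈ C.upper := by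
  -- the swapped cell is an N-cell by S₄-closure of the lower level
  have hsw : Z.perm (Equiv.swap σ f') = Function.update (Function.update Z σ (0, 0, 0)) f' (fu u) := by
    rw [perm_swap_eq_update Z hf, hZf, hZσ]
  have hN : Function.update (Function.update Z σ (0, 0, 0)) f' (fu u) ∈ C.lower := by
    rw [← hsw]; exact hPl _ Z hZ
  -- LEMMA A′: it is a P-cell
  have hP := a2i_swap_kill hU hA hZ hf hZσ hZf hq hN
  -- swap back inside the upper level
  have := hPu (Equiv.swap σ f') _ hP
  rwa [← hsw, perm_swap_swap] at this

end Summit.Ventures.HSemireg.Pad4Tower
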